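import Summits.QuantumFields.YangMills.Theorems.BalabanUVNodesN19TiltPathCalculus
import Summits.QuantumFields.BalabanUV.T4Continuum.Support.ShellMeasureHistoriesTransport

/-!
# BalabanUVNodes ∕ N14 — THE LAW CHANNEL'S PUSH-FORWARD DICTIONARY (LENS control memo v6.2 §D (D2), K12): a FINE-space tilt path,
# seen on the CLASS space, is the tilt path of FIBRE log-MGFs with the CONDITIONED direction; the drift is INVARIANT, the
# oscillation CONTRACTS, and the kernel-form conditioned direction IS the law channel's `μ[D | m]` letter

Cell `pub-ymgap` (HUMAN RULING D-0062, Track A at full width), node N14 = NE1′, seat `pub-ymgap-dag-n14-c` (R134 ACCELERATION, s1),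
generation 8; route `Summits/QuantumFields/YangMills/Theses/BalabanUVNodes.lean`, cluster K3⁶ `SpineGivenEndpointR13SepCoPR` (item
stmt-QuantumFields-20509; `--kind proof --supports … --as helper`, dag-lead WORDS-142).  ADDITIVE — imports dag-n19-c's module I
`Thm/BalabanUVNodesN19TiltPathCalculus` (p508225; Feynman–Hellmann along a tilt path; through it this lineage's file P `…N14LawChannel`)
and the T⁴ support leaf `Support/ShellMeasureHistoriesTransport` (the one-step push-forward identity
`map_withDensity_eq_withDensity_kernelTransport`, CITED; through it `Literature/…/T4AveragingDisintegration`: `jointLaw`, `condLaw`,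
`margDensity`, `kernelTransport`, `integral_graph_eq`, `integral_kernelTransport_mul`) ONLY; THEOREMS ONLY (0 `def`); edits nothing.  COUNT-NEUTRAL.

WHY (LENS control, seat `ym-lens-BalabanUVNodes-control`, memo `LENS-control.md` v6.2 §D (D2) + `Sketch-control-g9.lean` 27be075ad5a82fec §1,
«signatures, credit free, nobody's duty», bus l.17654).  dag-n19-c's road III (`…N19TiltPathRoad` p509274) proves MASS_cl ∕ TV_cl ∕ `Spine.NE7.Core`
∕ N14's binder `TiltedMeanMatching` from the DRIFT and the L¹-OSCILLATION of ANY tilt path `u ↦ e^{Ψ_u}·μA` between two runs' class pieces on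
ONE space.  As typed, III is inhabitable only with that space = the CLASS space: on the FINE space the raw L¹-oscillation of a one-step
log-density direction is EXTENSIVE at the record (lens census V56) — exactly the obstruction this lineage's law channel (file P p499366 §3,
`cauchySeq_genFun_of_condDefectTower`; 31-I p517989 `cauchySeq_genFun_of_tunedCondDefectTower`) routes around by CONDITIONING the
direction on the class (unit-lattice) field.  A fine-space path — straight or tuned (CARD 11, `…N14LawChannelTunedPath.exists_tuned_path`
p520761) — enters III through its PUSH-FORWARD along the class map `q`.  This module is that dictionary, in the kernel letters of the cell's
`T4AveragingDisintegration` (`condLaw ν q` = the conditional kernel of the fine variable given the class variable):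

* §1 THE COARSE REFERENCE IS THE IMAGE LAW: with `μ := ν.map q` the marginal density of `T4AveragingDisintegration` is `1` a.e.
  (`margDensity_map_self_ae`, Mathlib `Measure.rnDeriv_self`), so the kernel transport of a density `ρ` is `V ↦ ∫ ρ d(condLaw ν q V)` a.e.
  (`kernelTransport_map_self_ae`) and the disintegration reads `∫ g(qU, U) dν = ∫ (∫ g(V, U) d condLaw V) d(ν.map q)` (`integral_graph_eq_map`;
  tower `integral_eq_integral_condLaw`; tested form `integral_comp_mul_eq`).
* §2 K12a ∕ K12a′ DISCHARGED: ★ `map_withDensity_eq_withDensity_condLaw` — `(ρ·ν).map q = (∫ ρ d condLaw ·)·(ν.map q)` for every nonnegative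
  integrable `ρ` (the Support leaf's identity with the unit marginal density); for `ρ = e^{ψ}`, `ψ` bounded measurable (`T4VarianceMatching.Tilt.integrable_exp_of_abs_le` CITED): `fibreMGF_pos`,
  `integral_fibreMGF_eq` (`∫ (∫ e^ψ d condLaw V) d(ν.map q) = ∫ e^ψ dν`), ★ `map_withDensity_exp_eq_withDensity_fibreLogMGF` (`(e^ψ·ν).map q =
  e^{Λ}·(ν.map q)`, `Λ V = log ∫ e^ψ d(condLaw ν q V)` — road III's `hB` DOWNSTAIRS), ★ `map_tilted_eq_tilted_fibreLogMGF` (`(ν.tilted ψ).map q =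
  (ν.map q).tilted Λ`: the interpolating laws of a fine path, seen on the class space, are the tilts of the image law by the fibre log-MGFs).
* §3 what road III's letters need on the class space (the CONDITIONED DIRECTION `h(V) := ∫ g d((condLaw ν q V).tilted ψ)`):
  `condDirection_eq_div`, `measurable_fibreMGF`, `measurable_fibreLogMGF`, `measurable_condDirection` (Mathlib
  `StronglyMeasurable.integral_kernel`), `abs_condDirection_le`, `abs_condDirection_sub_le`, `fibreLogMGF_eq_zero` (`Ψ_0 = 0 ⇒ Λ_0 = 0`).
  (K12b ∕ K12b′ — the class-space path is a tilt path in module I's sense — are lifted with credit in the sibling module.)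
* §4 K12c ∕ K12d DISCHARGED + THE IDENTIFICATION: ★ `integral_mul_condDirection_eq` (`∫ f·h d((ν.tilted ψ).map q) = ∫ (f∘q)·g d(ν.tilted ψ)` for
  bounded measurable tests `f` on the class space), ★ `integral_condDirection_eq` (DRIFT IS INVARIANT: `∫ h d((ν.tilted ψ).map q) = ∫ g d(ν.tilted ψ)`),
  `setIntegral_condDirection_eq`, ★★ `condDirection_comp_ae_eq_condExp` (`h ∘ q =ᵐ[ν.tilted ψ] (ν.tilted ψ)[g | σ(q)]`, `σ(q) = mα.comap q` —
  the lens's KERNEL-form conditioned direction IS the law channel's condExp letter `μ[D | m]` of file P ∕ 31-I ∕ 34), ★ `condOsc_le_osc`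
  (OSCILLATION CONTRACTS: `∫ |h − c| d((ν.tilted ψ).map q) ≤ ∫ |g − c| d(ν.tilted ψ)` for every constant `c` — kernel Jensen; at the record the
  LEFT side is the (F2″) letter, the right side is extensive).
The JUNCTION with road III (fine DRIFT + CONDITIONED OSC ⇒ `Core` ∕ N14's binder BY NAME) is the sibling module `…N14LawChannelPushForwardRoad`
(via `…PushForwardPath`; a decided toy inhabitant is `…PushForwardToy`).
HONEST FRAMING.  [folklore] measure theory (disintegration of a finite measure along a measurable map into a standard Borel fibre, tower
property, Jensen) on hypothesis SHAPES — the lens's CURRENCY (F2″) made to meet road III's letters; no estimate of Bałaban's; every path ∕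
law in any application is NODE O's ∕ NE5–NE7's object, produced by nobody; NE1′ ∕ NE7 NOT PRINTED for d = 4 and NOT proved; N14 closes BY NAME
from §N19 (lens verdict, unchanged); N14 ∕ N19 NOT discharged; K3⁶ NOT claimed; counts UNMOVED (typed 28∕28 · discharged 5∕27 · A 5∕28); one
finite four-torus at fixed `ε` — NOT ℝ⁴, NOT OS, NOT a mass gap, NOT Clay.  0 `def`; 0 `sorry`; standard axioms.
-/

set_option autoImplicit false

noncomputable section

open MeasureTheory ProbabilityTheory Set Filter Topology
open scoped ENNReal NNReal

namespace YMDAG.N14.LawChannelPushForward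

open Literature.MathematicalPhysics.QuantumFieldTheory.Balaban1983to89.T4AveragingDisintegration
open Literature.MathematicalPhysics.QuantumFieldTheory.Balaban1983to89.T4TermReprCoupling (rnNN)
open Literature.MathematicalPhysics.QuantumFieldTheory.Balaban1983to89.T4VarianceMatching.Tilt (integrable_exp_of_abs_le)
open Summit.QuantumFields.BalabanUV.T4Continuum.ShellMeasureHistoriesTransport (map_withDensity_eq_withDensity_kernelTransport)
open Summit.QuantumFields.YangMills.BalabanUVNodes.N19TiltPathCalculus (integrable_of_abs_le integral_tilted_eq_div)

variable {α β : Type*} [MeasurableSpace α] [MeasurableSpace β] [StandardBorelSpace β] [Nonempty β]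
  (ν : Measure β) [IsFiniteMeasure ν] {q : β → α}

/-! ## §1 The coarse reference is the image law: unit marginal density, the disintegration along `q` -/

omit [StandardBorelSpace β] [Nonempty β] in
/-- With the image law `ν.map q` as coarse reference, the marginal density of `T4AveragingDisintegration` is `1` almost everywhere
(`(jointLaw ν q).fst = ν.map q`, Mathlib `Measure.rnDeriv_self`). [folklore] -/
theorem margDensity_map_self_ae (hq : Measurable q) :
    (fun V => (margDensity ν (ν.map q) q V : ℝ)) =ᵐ[ν.map q] fun _ => (1 : ℝ) := by
  have h1 : (ν.map q).rnDeriv (ν.map q) =ᵐ[ν.map q] fun _ => (1 : ℝ≥0∞) := Measure.rnDeriv_self _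
  rw [Filter.EventuallyEq, ae_iff] at h1 ⊢
  simp only [margDensity, rnNN, jointLaw_fst ν hq]
  refine measure_mono_null (fun V hV => ?_) h1
  intro hV1
  exact hV (by rw [hV1, ENNReal.toNNReal_one, NNReal.coe_one])

/-- Hence the kernel transport of any density `ρ` is `V ↦ ∫ ρ d(condLaw ν q V)` almost everywhere. [folklore] -/
theorem kernelTransport_map_self_ae (hq : Measurable q) (ρ : β → ℝ) :
    kernelTransport ν (ν.map q) q ρ =ᵐ[ν.map q] fun V => ∫ U, ρ U ∂(condLaw ν q V) := by
  filter_upwards [margDensity_map_self_ae ν hq] with V hV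
  simp only [kernelTransport, hV, one_mul]

/-- **THE DISINTEGRATION ALONG `q`, integrated form**: `∫ g(qU, U) dν = ∫ (∫ g(V, U) d(condLaw ν q V)) d(ν.map q)` for `g` a.e. strongly
measurable on the joint law with `U ↦ g(qU, U)` integrable (`integral_graph_eq` with the unit marginal density). [folklore] -/
theorem integral_graph_eq_map (hq : Measurable q) {g : α × β → ℝ} (hgm : AEStronglyMeasurable g (jointLaw ν q))
    (hg : Integrable (fun U => g (q U, U)) ν) :
    ∫ U, g (q U, U) ∂ν = ∫ V, (∫ U, g (V, U) ∂(condLaw ν q V)) ∂(ν.map q) := by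
  rw [integral_graph_eq ν (ν.map q) hq Measure.AbsolutelyContinuous.rfl hgm hg]
  refine integral_congr_ae ?_
  filter_upwards [margDensity_map_self_ae ν hq] with V hV
  rw [hV, one_mul]

/-- **THE TOWER PROPERTY in kernel form**: `∫ ρ dν = ∫ (∫ ρ d(condLaw ν q V)) d(ν.map q)` for integrable `ρ`. [folklore] -/
theorem integral_eq_integral_condLaw (hq : Measurable q) {ρ : β → ℝ} (hρ : Integrable ρ ν) :
    ∫ U, ρ U ∂ν = ∫ V, (∫ U, ρ U ∂(condLaw ν q V)) ∂(ν.map q) :=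
  integral_graph_eq_map ν hq (g := fun z : α × β => ρ z.2) (aestronglyMeasurable_comp_snd_jointLaw ν hq hρ.1) hρ

/-- **THE PUSH-FORWARD IDENTITY tested against a bounded measurable class-space function**:
`∫ f(qU)·ρ(U) dν = ∫ f(V)·(∫ ρ d(condLaw ν q V)) d(ν.map q)` (`integral_kernelTransport_mul` with the unit marginal density). [folklore] -/
theorem integral_comp_mul_eq (hq : Measurable q) {ρ : β → ℝ} (hρ : Integrable ρ ν) {f : α → ℝ} (hf : Measurable f) {C : ℝ}
    (hC : ∀ V, |f V| ≤ C) :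
    ∫ U, f (q U) * ρ U ∂ν = ∫ V, f V * ∫ U, ρ U ∂(condLaw ν q V) ∂(ν.map q) := by
  have key := integral_kernelTransport_mul ν (ν.map q) hq Measure.AbsolutelyContinuous.rfl hρ hf hC
  have e : ∫ V, kernelTransport ν (ν.map q) q ρ V * f V ∂(ν.map q) = ∫ V, f V * ∫ U, ρ U ∂(condLaw ν q V) ∂(ν.map q) := by
    refine integral_congr_ae ?_
    filter_upwards [kernelTransport_map_self_ae ν hq ρ] with V hV
    rw [hV, mul_comm]
  rw [← e, key]
  exact integral_congr_ae (Eventually.of_forall fun U => mul_comm _ _)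

/-! ## §2 (K12a ∕ K12a′) The image of a tilted fine law is the image law tilted by the fibre (log-)MGF -/

/-- ★ **K12a, GENERAL DENSITY.**  For a nonnegative `ν`-integrable density `ρ`:
`(ρ·ν).map q = (V ↦ ∫ ρ d(condLaw ν q V))·(ν.map q)` — the Support leaf's `map_withDensity_eq_withDensity_kernelTransport` with coarse
reference the image law (unit marginal density). [folklore] -/
theorem map_withDensity_eq_withDensity_condLaw (hq : Measurable q) {ρ : β → ℝ} (hρ : Integrable ρ ν) (h0 : ∀ U, 0 ≤ ρ U) :
    (ν.withDensity fun U => ENNReal.ofReal (ρ U)).map q =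
      (ν.map q).withDensity fun V => ENNReal.ofReal (∫ U, ρ U ∂(condLaw ν q V)) := by
  rw [map_withDensity_eq_withDensity_kernelTransport ν (ν.map q) hq Measure.AbsolutelyContinuous.rfl hρ h0]
  refine withDensity_congr_ae ?_
  filter_upwards [kernelTransport_map_self_ae ν hq ρ] with V hV
  rw [hV]

section Exp

variable {ψ : β → ℝ} {M : ℝ}

/-- The fibre MGF `∫ e^{ψ} d(condLaw ν q V)` is POSITIVE at every class point (the kernel is Markov). [folklore] -/
theorem fibreMGF_pos (hψm : Measurable ψ) (hψb : ∀ U, |ψ U| ≤ M) (V : α) :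
    0 < ∫ U, Real.exp (ψ U) ∂(condLaw ν q V) :=
  integral_exp_pos (integrable_exp_of_abs_le (μ := condLaw ν q V) hψm hψb)

/-- Two-sided bounds of the fibre MGF: `e^{−M} ≤ ∫ e^{ψ} d(condLaw ν q V) ≤ e^{M}`. [folklore] -/
theorem fibreMGF_mem_Icc (hψm : Measurable ψ) (hψb : ∀ U, |ψ U| ≤ M) (V : α) :
    ∫ U, Real.exp (ψ U) ∂(condLaw ν q V) ∈ Icc (Real.exp (-M)) (Real.exp M) := by
  have hint := integrable_exp_of_abs_le (μ := condLaw ν q V) hψm hψb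
  constructor
  · have := integral_mono (integrable_const (Real.exp (-M))) hint fun U =>
      Real.exp_le_exp.2 (neg_le.1 ((neg_le_abs _).trans (hψb U)))
    simpa using this
  · have := integral_mono hint (integrable_const (Real.exp M)) fun U =>
      Real.exp_le_exp.2 ((le_abs_self _).trans (hψb U))
    simpa using this

/-- **TOWER FOR THE MGF**: `∫ (∫ e^{ψ} d(condLaw ν q V)) d(ν.map q) = ∫ e^{ψ} dν` — the normalisations of the fine tilted law and of the
image law tilted by the fibre log-MGF AGREE. [folklore] -/
theorem integral_fibreMGF_eq (hq : Measurable q) (hψm : Measurable ψ) (hψb : ∀ U, |ψ U| ≤ M) :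
    ∫ V, (∫ U, Real.exp (ψ U) ∂(condLaw ν q V)) ∂(ν.map q) = ∫ U, Real.exp (ψ U) ∂ν :=
  (integral_eq_integral_condLaw ν hq (integrable_exp_of_abs_le (μ := ν) hψm hψb)).symm

/-- ★ **K12a (LENS control `Sketch-control-g9` §1, DISCHARGED).**  `(e^{ψ}·ν).map q = e^{Λ}·(ν.map q)` with the FIBRE LOG-MGF
`Λ V = log ∫ e^{ψ} d(condLaw ν q V)` — road III's hypothesis `hB` («run B's piece is run A's piece tilted by `e^{Ψ_1}`») DOWNSTAIRS, for the
images of two fine pieces so related. [folklore] -/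
theorem map_withDensity_exp_eq_withDensity_fibreLogMGF (hq : Measurable q) (hψm : Measurable ψ) (hψb : ∀ U, |ψ U| ≤ M)
    {Λ : α → ℝ} (hΛ : ∀ V, Λ V = Real.log (∫ U, Real.exp (ψ U) ∂(condLaw ν q V))) :
    (ν.withDensity fun U => ENNReal.ofReal (Real.exp (ψ U))).map q =
      (ν.map q).withDensity fun V => ENNReal.ofReal (Real.exp (Λ V)) := by
  rw [map_withDensity_eq_withDensity_condLaw ν hq (integrable_exp_of_abs_le (μ := ν) hψm hψb) fun U => (Real.exp_pos _).le]
  refine withDensity_congr_ae (Eventually.of_forall fun V => ?_)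
  show ENNReal.ofReal _ = ENNReal.ofReal _
  rw [hΛ V, Real.exp_log (fibreMGF_pos ν hψm hψb V)]

/-- ★ **K12a′ (LENS control, DISCHARGED) — THE INTERPOLATING LAWS SEEN ON THE CLASS SPACE.**  `(ν.tilted ψ).map q = (ν.map q).tilted Λ`:
the image of the fine law tilted by `ψ` is the image law tilted by the fibre log-MGF `Λ` (same normalisation by `integral_fibreMGF_eq`).
[folklore] -/
theorem map_tilted_eq_tilted_fibreLogMGF (hq : Measurable q) (hψm : Measurable ψ) (hψb : ∀ U, |ψ U| ≤ M)
    {Λ : α → ℝ} (hΛ : ∀ V, Λ V = Real.log (∫ U, Real.exp (ψ U) ∂(condLaw ν q V))) :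
    (ν.tilted ψ).map q = (ν.map q).tilted Λ := by
  set Z : ℝ := ∫ U, Real.exp (ψ U) ∂ν with hZ
  have hint := integrable_exp_of_abs_le (μ := ν) hψm hψb
  -- the fine tilted law as a density with the constant `Z⁻¹` pulled in
  have e1 : ν.tilted ψ = ν.withDensity fun U => ENNReal.ofReal (Real.exp (ψ U) / Z) := rfl
  have hρi : Integrable (fun U => Real.exp (ψ U) / Z) ν := hint.div_const Z
  have hρ0 : ∀ U, 0 ≤ Real.exp (ψ U) / Z := fun U =>
    div_nonneg (Real.exp_pos _).le (integral_nonneg fun _ => (Real.exp_pos _).le)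
  rw [e1, map_withDensity_eq_withDensity_condLaw ν hq hρi hρ0]
  -- the coarse side: `exp Λ = fibre MGF`, normalisation `∫ exp Λ d(ν.map q) = Z`
  have hexpΛ : ∀ V, Real.exp (Λ V) = ∫ U, Real.exp (ψ U) ∂(condLaw ν q V) := fun V => by
    rw [hΛ V, Real.exp_log (fibreMGF_pos ν hψm hψb V)]
  have hZ' : ∫ V, Real.exp (Λ V) ∂(ν.map q) = Z := by
    rw [hZ, ← integral_fibreMGF_eq ν hq hψm hψb]
    exact integral_congr_ae (Eventually.of_forall hexpΛ)
  show _ = (ν.map q).withDensity fun V => ENNReal.ofReal (Real.exp (Λ V) / ∫ V, Real.exp (Λ V) ∂(ν.map q))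
  rw [hZ']
  refine withDensity_congr_ae (Eventually.of_forall fun V => ?_)
  show ENNReal.ofReal _ = ENNReal.ofReal _
  rw [hexpΛ V, integral_div]

end Exp

/-! ## §3 What road III's letters need on the class space: measurability, bounds, the start -/

section Direction

variable {ψ g : β → ℝ} {M B : ℝ}

/-- The conditioned direction as a QUOTIENT of two fibre integrals: `h(V) = (∫ g·e^{ψ} d condLaw V) ∕ (∫ e^{ψ} d condLaw V)`. [folklore] -/
theorem condDirection_eq_div (V : α) :
    ∫ U, g U ∂((condLaw ν q V).tilted ψ) =
      (∫ U, g U * Real.exp (ψ U) ∂(condLaw ν q V)) / ∫ U, Real.exp (ψ U) ∂(condLaw ν q V) :=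
  integral_tilted_eq_div ψ g

/-- Measurability in the class point of the fibre integral of a measurable integrand (Mathlib `StronglyMeasurable.integral_kernel`).
[folklore] -/
theorem measurable_integral_condLaw {φ : β → ℝ} (hφm : Measurable φ) :
    Measurable fun V => ∫ U, φ U ∂(condLaw ν q V) :=
  (hφm.stronglyMeasurable.integral_kernel (κ := condLaw ν q)).measurable

/-- The fibre MGF is measurable in the class point. [folklore] -/
theorem measurable_fibreMGF (hψm : Measurable ψ) :
    Measurable fun V => ∫ U, Real.exp (ψ U) ∂(condLaw ν q V) :=
  measurable_integral_condLaw ν (Real.measurable_exp.comp hψm)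

/-- The fibre log-MGF `Λ` is measurable in the class point. [folklore] -/
theorem measurable_fibreLogMGF (hψm : Measurable ψ) {Λ : α → ℝ}
    (hΛ : ∀ V, Λ V = Real.log (∫ U, Real.exp (ψ U) ∂(condLaw ν q V))) : Measurable Λ := by
  have e : Λ = fun V => Real.log (∫ U, Real.exp (ψ U) ∂(condLaw ν q V)) := funext hΛ
  rw [e]
  exact Real.measurable_log.comp (measurable_fibreMGF ν hψm)

/-- The conditioned direction `h` is measurable in the class point. [folklore] -/
theorem measurable_condDirection (hψm : Measurable ψ) (hgm : Measurable g) {h : α → ℝ}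
    (hh : ∀ V, h V = ∫ U, g U ∂((condLaw ν q V).tilted ψ)) : Measurable h := by
  have e : h = fun V => (∫ U, g U * Real.exp (ψ U) ∂(condLaw ν q V)) / ∫ U, Real.exp (ψ U) ∂(condLaw ν q V) :=
    funext fun V => by rw [hh V, condDirection_eq_div]
  rw [e]
  exact (measurable_integral_condLaw ν (hgm.mul (Real.measurable_exp.comp hψm))).div (measurable_fibreMGF ν hψm)

/-- The fibre tilted laws are probability measures (Markov fibres, bounded exponent). [folklore] -/
theorem isProbabilityMeasure_condLaw_tilted (hψm : Measurable ψ) (hψb : ∀ U, |ψ U| ≤ M) (V : α) :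
    IsProbabilityMeasure ((condLaw ν q V).tilted ψ) :=
  isProbabilityMeasure_tilted (integrable_exp_of_abs_le hψm hψb)

/-- The conditioned direction of a `B`-bounded integrand is `B`-bounded. [folklore] -/
theorem abs_condDirection_le (hψm : Measurable ψ) (hψb : ∀ U, |ψ U| ≤ M) (hgb : ∀ U, |g U| ≤ B) (V : α) :
    |∫ U, g U ∂((condLaw ν q V).tilted ψ)| ≤ B := by
  haveI := isProbabilityMeasure_condLaw_tilted ν (q := q) hψm hψb V
  calc |∫ U, g U ∂((condLaw ν q V).tilted ψ)| ≤ ∫ U, |g U| ∂((condLaw ν q V).tilted ψ) := abs_integral_le_integral_abs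
    _ ≤ ∫ U, B ∂((condLaw ν q V).tilted ψ) :=
        integral_mono_of_nonneg (Eventually.of_forall fun U => abs_nonneg _) (integrable_const B) (Eventually.of_forall hgb)
    _ = B := by simp

/-- A conditioned difference is dominated fibrewise: `|h(V) − c| ≤ ∫ |g − c| d((condLaw ν q V).tilted ψ)` (Jensen on a probability
fibre). [folklore] -/
theorem abs_condDirection_sub_le (hψm : Measurable ψ) (hψb : ∀ U, |ψ U| ≤ M) (hgm : Measurable g) (hgb : ∀ U, |g U| ≤ B)
    (c : ℝ) (V : α) :
    |(∫ U, g U ∂((condLaw ν q V).tilted ψ)) - c| ≤ ∫ U, |g U - c| ∂((condLaw ν q V).tilted ψ) := by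
  haveI := isProbabilityMeasure_condLaw_tilted ν (q := q) hψm hψb V
  have hgi : Integrable g ((condLaw ν q V).tilted ψ) := integrable_of_abs_le hgm hgb
  have e : (∫ U, g U ∂((condLaw ν q V).tilted ψ)) - c = ∫ U, (g U - c) ∂((condLaw ν q V).tilted ψ) := by
    rw [integral_sub hgi (integrable_const c), integral_const]; simp
  rw [e]
  exact abs_integral_le_integral_abs

/-- `Ψ_0 = 0 ⇒ Λ_0 = 0`: the class-space path starts at run A's image piece, as road III's `hΨ0` wants. [folklore] -/
theorem fibreLogMGF_eq_zero {Ψ : ℝ → β → ℝ} (hΨ0 : ∀ x, Ψ 0 x = 0) (V : α) :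
    Real.log (∫ U, Real.exp (Ψ 0 U) ∂(condLaw ν q V)) = 0 := by
  simp [hΨ0]

end Direction

/-! ## §4 (K12c ∕ K12d) The drift is invariant, the oscillation contracts; the kernel form IS the condExp letter -/

section Tower

variable {ψ g : β → ℝ} {M B : ℝ}

/-- ★ **THE TESTED TOWER IDENTITY.**  For a bounded measurable class-space test `f`:
`∫ f·h d((ν.tilted ψ).map q) = ∫ (f∘q)·g d(ν.tilted ψ)`, `h(V) = ∫ g d((condLaw ν q V).tilted ψ)` — two applications of the push-forward
identity `integral_comp_mul_eq` (densities `e^{ψ}` and `g·e^{ψ}`) and the quotient form of `h`. [folklore] -/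
theorem integral_mul_condDirection_eq (hq : Measurable q) (hψm : Measurable ψ) (hψb : ∀ U, |ψ U| ≤ M) (hgm : Measurable g)
    (hgb : ∀ U, |g U| ≤ B) {h : α → ℝ} (hh : ∀ V, h V = ∫ U, g U ∂((condLaw ν q V).tilted ψ))
    {f : α → ℝ} (hfm : Measurable f) {C : ℝ} (hfb : ∀ V, |f V| ≤ C) :
    ∫ V, f V * h V ∂((ν.tilted ψ).map q) = ∫ U, f (q U) * g U ∂(ν.tilted ψ) := by
  have hhm : Measurable h := measurable_condDirection ν hψm hgm hh
  have hexp : Integrable (fun U => Real.exp (ψ U)) ν := integrable_exp_of_abs_le (μ := ν) hψm hψb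
  have hgexp : Integrable (fun U => g U * Real.exp (ψ U)) ν :=
    hexp.bdd_mul hgm.aestronglyMeasurable (Eventually.of_forall fun U => by rw [Real.norm_eq_abs]; exact hgb U)
  -- (i) unfold the map and the tilt into a quotient of fine integrals
  have hB0 : 0 ≤ B := (abs_nonneg _).trans (hgb (Classical.arbitrary β))
  have hfh : ∀ V, |f V * h V| ≤ C * B := fun V => by
    rw [abs_mul]
    exact mul_le_mul (hfb V) (by rw [hh V]; exact abs_condDirection_le ν hψm hψb hgb V) (abs_nonneg _)
      ((abs_nonneg _).trans (hfb V))
  have hfhm : AEStronglyMeasurable (fun V => f V * h V) ((ν.tilted ψ).map q) := (hfm.mul hhm).aestronglyMeasurable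
  rw [integral_map hq.aemeasurable hfhm, integral_tilted_eq_div, integral_tilted_eq_div]
  congr 1
  -- (ii) numerators: `∫ f(qU) h(qU) e^{ψ U} dν = ∫ f V h V (∫ e^ψ d condLaw V) d(ν.map q) = ∫ f V (∫ g e^ψ d condLaw V) d(ν.map q) = ∫ f(qU) g U e^{ψ U} dν`
  have step1 := integral_comp_mul_eq ν hq hexp (hfm.mul hhm) hfh
  have step2 := integral_comp_mul_eq ν hq hgexp hfm hfb
  have e : ∀ V, f V * h V * ∫ U, Real.exp (ψ U) ∂(condLaw ν q V) = f V * ∫ U, g U * Real.exp (ψ U) ∂(condLaw ν q V) := by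
    intro V
    rw [hh V, condDirection_eq_div, mul_assoc, div_mul_cancel₀ _ (fibreMGF_pos ν hψm hψb V).ne']
  calc ∫ U, f (q U) * h (q U) * Real.exp (ψ U) ∂ν
      = ∫ V, f V * h V * ∫ U, Real.exp (ψ U) ∂(condLaw ν q V) ∂(ν.map q) := step1
    _ = ∫ V, f V * ∫ U, g U * Real.exp (ψ U) ∂(condLaw ν q V) ∂(ν.map q) := integral_congr_ae (Eventually.of_forall e)
    _ = ∫ U, f (q U) * (g U * Real.exp (ψ U)) ∂ν := step2.symm
    _ = ∫ U, f (q U) * g U * Real.exp (ψ U) ∂ν := integral_congr_ae (Eventually.of_forall fun U => by ring)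

/-- ★ **K12c (LENS control, DISCHARGED) — THE DRIFT IS INVARIANT.**  The class-space tilted mean of the conditioned direction equals the
fine tilted mean of the raw direction: `∫ h d((ν.tilted ψ).map q) = ∫ g d(ν.tilted ψ)` (tower property ∕ Bayes; with K12a′ the left side is
`∫ h d((ν.map q).tilted Λ)`, road III's DRIFT datum for the pushed-forward path). [folklore] -/
theorem integral_condDirection_eq (hq : Measurable q) (hψm : Measurable ψ) (hψb : ∀ U, |ψ U| ≤ M) (hgm : Measurable g)
    (hgb : ∀ U, |g U| ≤ B) {h : α → ℝ} (hh : ∀ V, h V = ∫ U, g U ∂((condLaw ν q V).tilted ψ)) :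
    ∫ V, h V ∂((ν.tilted ψ).map q) = ∫ U, g U ∂(ν.tilted ψ) := by
  have := integral_mul_condDirection_eq ν hq hψm hψb hgm hgb hh (f := fun _ => (1 : ℝ)) measurable_const (C := 1)
    (fun _ => by simp)
  simpa using this

/-- **K12c ON SETS**: `∫_{S} h d((ν.tilted ψ).map q) = ∫_{q⁻¹S} g d(ν.tilted ψ)` for every measurable class-space set `S`. [folklore] -/
theorem setIntegral_condDirection_eq (hq : Measurable q) (hψm : Measurable ψ) (hψb : ∀ U, |ψ U| ≤ M) (hgm : Measurable g)
    (hgb : ∀ U, |g U| ≤ B) {h : α → ℝ} (hh : ∀ V, h V = ∫ U, g U ∂((condLaw ν q V).tilted ψ))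
    {S : Set α} (hS : MeasurableSet S) :
    ∫ V in S, h V ∂((ν.tilted ψ).map q) = ∫ U in q ⁻¹' S, g U ∂(ν.tilted ψ) := by
  have key := integral_mul_condDirection_eq ν hq hψm hψb hgm hgb hh (f := S.indicator fun _ => (1 : ℝ))
    (measurable_const.indicator hS) (C := 1) (fun V => by by_cases hV : V ∈ S <;> simp [hV])
  have e1 : (fun V => S.indicator (fun _ => (1 : ℝ)) V * h V) = S.indicator h := by
    funext V; by_cases hV : V ∈ S <;> simp [hV]
  have e2 : (fun U => S.indicator (fun _ => (1 : ℝ)) (q U) * g U) = (q ⁻¹' S).indicator g := by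
    funext U
    by_cases hU : q U ∈ S
    · have hU' : U ∈ q ⁻¹' S := hU
      simp [hU, hU']
    · have hU' : U ∉ q ⁻¹' S := hU
      simp [hU, hU']
  rw [e1, e2, integral_indicator hS, integral_indicator (hq hS)] at key
  exact key

/-- ★★ **THE IDENTIFICATION — the lens's KERNEL-form conditioned direction IS the law channel's condExp letter.**  Under the fine tilted law
`ν̂ = ν.tilted ψ` (finite `ν ≠ 0`, bounded `ψ`), `h ∘ q` is a version of the conditional expectation of `g` given the class variable:
`h ∘ q =ᵐ[ν̂] ν̂[g | mα.comap q]` — so file P's `μ[D | m]` (p499366 §3), 31-I's tuned `b K` (p517989) and 34's `cauchySeq_genFun_of_tunedData`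
(p525061) speak about exactly the direction road III sees on the class space after push-forward. [folklore] -/
theorem condDirection_comp_ae_eq_condExp [NeZero ν] (hq : Measurable q) (hψm : Measurable ψ) (hψb : ∀ U, |ψ U| ≤ M)
    (hgm : Measurable g) (hgb : ∀ U, |g U| ≤ B) {h : α → ℝ} (hh : ∀ V, h V = ∫ U, g U ∂((condLaw ν q V).tilted ψ)) :
    (h ∘ q) =ᵐ[ν.tilted ψ] (ν.tilted ψ)[g | MeasurableSpace.comap q inferInstance] := by
  haveI : IsProbabilityMeasure (ν.tilted ψ) := isProbabilityMeasure_tilted (integrable_exp_of_abs_le (μ := ν) hψm hψb)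
  have hhm : Measurable h := measurable_condDirection ν hψm hgm hh
  have hm : MeasurableSpace.comap q (inferInstance : MeasurableSpace α) ≤ (inferInstance : MeasurableSpace β) :=
    hq.comap_le
  have hgi : Integrable g (ν.tilted ψ) := integrable_of_abs_le hgm hgb
  -- `h ∘ q` is `σ(q)`-measurable and bounded
  have hhq : StronglyMeasurable[MeasurableSpace.comap q inferInstance] (h ∘ q) := by
    refine Measurable.stronglyMeasurable ?_
    exact hhm.comp (Measurable.of_comap_le le_rfl)
  have hhqi : Integrable (h ∘ q) (ν.tilted ψ) :=
    integrable_of_abs_le (hhm.comp hq) fun U => by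
      simp only [Function.comp_apply, hh]; exact abs_condDirection_le ν hψm hψb hgb (q U)
  refine ae_eq_condExp_of_forall_setIntegral_eq hm hgi (fun s _ _ => hhqi.integrableOn) ?_
    hhq.aestronglyMeasurable
  intro s hs _
  -- sets of `σ(q)` are preimages
  obtain ⟨S, hS, rfl⟩ := hs
  rw [← setIntegral_condDirection_eq ν hq hψm hψb hgm hgb hh hS, setIntegral_map hS hhm.aestronglyMeasurable hq.aemeasurable]
  rfl

/-- ★ **K12d (LENS control, DISCHARGED) — THE OSCILLATION CONTRACTS.**  For every constant `c`:
`∫ |h − c| d((ν.tilted ψ).map q) ≤ ∫ |g − c| d(ν.tilted ψ)` — the class-space L¹-oscillation of the CONDITIONED direction is at most the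
fine-space L¹-oscillation of the raw direction (fibrewise Jensen `abs_condDirection_sub_le`, then K12c on `|g − c|`).  At the record the LEFT
side is the (F2″) letter this lineage's law channel keys; the right side is EXTENSIVE (lens census V56) — road III must be fed the left side,
which the sibling module does. [folklore] -/
theorem condOsc_le_osc (hq : Measurable q) (hψm : Measurable ψ) (hψb : ∀ U, |ψ U| ≤ M) (hgm : Measurable g)
    (hgb : ∀ U, |g U| ≤ B) {h : α → ℝ} (hh : ∀ V, h V = ∫ U, g U ∂((condLaw ν q V).tilted ψ)) (c : ℝ) :
    ∫ V, |h V - c| ∂((ν.tilted ψ).map q) ≤ ∫ U, |g U - c| ∂(ν.tilted ψ) := by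
  have hhm : Measurable h := measurable_condDirection ν hψm hgm hh
  -- the fibrewise majorant `V ↦ ∫ |g − c| d((condLaw V).tilted ψ)` is the conditioned direction of `|g − c|`
  have hgc_m : Measurable fun U => |g U - c| := (hgm.sub measurable_const).abs
  have hgc_b : ∀ U, |(fun U => |g U - c|) U| ≤ B + |c| := fun U => by
    simp only [abs_abs]
    linarith [abs_sub (g U) c, hgb U]
  have key := integral_condDirection_eq ν hq hψm hψb hgc_m hgc_b (h := fun V => ∫ U, |g U - c| ∂((condLaw ν q V).tilted ψ))
    (fun _ => rfl)
  rw [← key]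
  haveI : IsFiniteMeasure ((ν.tilted ψ).map q) := by infer_instance
  refine integral_mono_of_nonneg (Eventually.of_forall fun V => abs_nonneg _) ?_ (Eventually.of_forall fun V => ?_)
  · exact integrable_of_abs_le (measurable_condDirection ν hψm hgc_m (fun _ => rfl)) fun V =>
      abs_condDirection_le ν hψm hψb hgc_b V
  · show |h V - c| ≤ _
    rw [hh V]
    exact abs_condDirection_sub_le ν hψm hψb hgm hgb c V

end Tower

end YMDAG.N14.LawChannelPushForward

end
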